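import Summits.BirchSwinnertonDyer.BirchSwinnertonDyer.Theorems.EdixhovenFibreFiveSevenLTwistTransferWitness
import Literature.NumberTheory.EllipticCurves.TorsionGaloisRepMatrixProofs
import Literature.NumberTheory.EllipticCurves.DeligneSerreWeightOneIrreducibleKroneckerWeberProofs
import HarnessLib

/-!
# The TRANSFER WITNESS for curves with SURJECTIVE mod-`p` image — PROVED (route `EdixhovenFibreFiveSeven`,
# crux TDS57, `--supports`; ROAD A′ part 6)

Cell `pub/bsd-wall` (D-0145 line `route-BirchSwinnertonDyer-EdixhovenFibreFiveSeven`), seat `bsd-line-edix-p3`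
(prover). THEOREMS ONLY (no definition, no named fact, no `sorry`); route-free. BSD is not proved by this file.

`LTwistTransferWitness.transferWitness_of_galois` (p595624) reduces the auxiliary-prime hypothesis `hW″` of the
Ihara-free L-TWIST chain to the existence, per curve, of `σ ∈ Γ_ℚ` with `χ_{4p}(σ)` in a good class and
`ρ̄_{E,p}(σ)` without eigenvalue `±1`. Here that element is CONSTRUCTED when `ρ̄_{E,p}` is onto `GL₂(𝔽_p)`
(`W.HasSurjectiveModNGaloisRep p`, the ♯-locus condition of the W-ALL rung), `p ∈ {5, 7}`:
take `ζ` with `χ_{4p}(ζ) = 2p + 3` (`≡ 1 mod 4`, `≡ 3 mod p`; surjectivity of `χ_{4p}` on `Γ_ℚ`, tree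
`modNCyclotomicCharacter_rat_surjective`), `z = ρ̄(ζ)` (`det z = χ̄_p(ζ) = 3`, Weil pairing), and multiply `ζ` by
one or two COMMUTATORS `[x, y]` of Galois elements (`χ_{4p}([x,y]) = 1`) whose images are the transvections
`[diag(−1,1), (1 t; 0 1)] = (1 −2t; 0 1)`, `[diag(−1,1), (1 0; u 1)] = (1 0; −2u 1)` (surjectivity of `ρ̄`,
tree `hasSurjectiveModNGaloisRep_iff_matrix`), chosen so that `tr(z k) = 0`: then `det(zk ∓ 1) = 4 ≠ 0`.

* `transferClass_facts` — `ℓ ≡ 2p + 3 (mod 4p)` ⟹ `ℓ* = ℓ` is a non-residue mod `p` and `ℓ ≢ 1 (mod p)`;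
* `exists_galois_transfer_of_surjective` — the Galois element;
* `transferWitness_of_surjective` — `hW″` restricted to curves with surjective mod-`p` image, PROVED; hence for
  such curves TDS57 / KP57 / AKR #7 rest on F″ ALONE (`…_of_kato_of_transferWitness`, p594464).

References: [SilvermanAEC2009] III.7, III.8.1; [SilvermanCSS1997] II §7–8; [Washington1997] Thm. 2.5;
[Serre1972] §4.
-/

set_option autoImplicit false
-- the Theorems directory repeats the summit name (sibling precedent `SignedBaseChangeAssembly.lean`)
set_option linter.dupNamespace false

noncomputable section

open scoped Classical MatrixGroups commutatorElement

open WeierstrassCurve NumberField IsDedekindDomain Field Matrix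
  Literature.NumberTheory.EllipticCurves Literature.NumberTheory.GaloisRepresentations
  Literature.NumberTheory.EllipticCurves.Rank1Residual
  Literature.NumberTheory.EllipticCurves.DokchitserDokchitser2012

namespace Summit.BirchSwinnertonDyer.BirchSwinnertonDyer.Theorems.LTwistTransfer

/-! ### §1 The class `2p + 3 (mod 4p)` -/

/-- `n ≠ 0` in `𝔽_p` for `0 < n < p`. [folklore] -/
theorem natCast_zmod_ne_zero_of_lt {p n : ℕ} [NeZero p] (h0 : 0 < n) (hn : n < p) : ((n : ℕ) : ZMod p) ≠ 0 := by
  rw [Ne, ZMod.natCast_eq_zero_iff]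
  exact Nat.not_dvd_of_pos_of_lt h0 hn

/-- `3` is not a square mod `5`. [folklore] -/
theorem not_isSquare_three_zmod_five : ¬ IsSquare (3 : ZMod 5) := by decide

/-- `3` is not a square mod `7`. [folklore] -/
theorem not_isSquare_three_zmod_seven : ¬ IsSquare (3 : ZMod 7) := by decide

/-- For `p ∈ {5, 7}` and `ℓ ≡ 2p + 3 (mod 4p)`: `ℓ ≡ 1 (mod 4)`, so `ℓ* = ℓ ≡ 3 (mod p)` is a non-residue,
and `ℓ ≢ 1 (mod p)`. [folklore] -/
theorem transferClass_facts {p : ℕ} [Fact p.Prime] (hp57 : p = 5 ∨ p = 7) {ℓ : ℕ}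
    (hℓ : (ℓ : ZMod (4 * p)) = ((2 * p + 3 : ℕ) : ZMod (4 * p))) :
    ¬ IsSquare ((((-1 : ℤ) ^ (ℓ / 2) * ℓ : ℤ)) : ZMod p) ∧ ¬ (p : ℤ) ∣ (ℓ : ℤ) - 1 := by
  have hmod : ℓ ≡ 2 * p + 3 [MOD 4 * p] := (ZMod.natCast_eq_natCast_iff _ _ _).mp hℓ
  have h4 : ℓ % 4 = 1 := by
    have := (hmod.of_mul_right p : ℓ ≡ 2 * p + 3 [MOD 4])
    rcases hp57 with rfl | rfl <;> exact this
  have hmp : ℓ % p = 3 % p := by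
    have := (hmod.of_mul_left 4 : ℓ ≡ 2 * p + 3 [MOD p])
    unfold Nat.ModEq at this
    rw [this, Nat.add_mod, Nat.mul_mod_left, zero_add, Nat.mod_mod]
  have heven : Even (ℓ / 2) := ⟨ℓ / 4, by omega⟩
  have hstar : ((-1 : ℤ) ^ (ℓ / 2) * ℓ : ℤ) = ℓ := by rw [heven.neg_one_pow, one_mul]
  have hℓ3 : (ℓ : ZMod p) = 3 := by
    have : (ℓ : ZMod p) = ((3 : ℕ) : ZMod p) := (ZMod.natCast_eq_natCast_iff' ℓ 3 p).mpr hmp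
    rw [this, Nat.cast_ofNat]
  haveI : NeZero p := ⟨(Fact.out : p.Prime).ne_zero⟩
  refine ⟨?_, ?_⟩
  · rw [hstar, Int.cast_natCast, hℓ3]
    rcases hp57 with rfl | rfl
    · exact not_isSquare_three_zmod_five
    · exact not_isSquare_three_zmod_seven
  · rw [← ZMod.intCast_zmod_eq_zero_iff_dvd]
    push_cast
    rw [hℓ3, show (3 : ZMod p) - 1 = ((2 : ℕ) : ZMod p) by norm_num]
    exact natCast_zmod_ne_zero_of_lt two_pos (by rcases hp57 with rfl | rfl <;> norm_num)

/-! ### §2 Matrices: trace-zero adjustment by transvections -/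

/-- A `2 × 2` matrix over `𝔽_p` (`p ∈ {5,7}`) with trace `0` and determinant `3` has no eigenvalue `±1`:
`det(M ∓ 1) = 1 ∓ tr M + det M = 4 ≠ 0`. [folklore] -/
theorem mulVec_eq_smul_sign_imp_zero {p : ℕ} [Fact p.Prime] (hp57 : p = 5 ∨ p = 7)
    {M : Matrix (Fin 2) (Fin 2) (ZMod p)} (htr : M 0 0 + M 1 1 = 0) (hdet : M.det = 3)
    {ε : ZMod p} (hε : ε = 1 ∨ ε = -1) {x : Fin 2 → ZMod p} (hx : M.mulVec x = ε • x) : x = 0 := by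
  by_contra hx0
  have h0 : (M - ε • (1 : Matrix (Fin 2) (Fin 2) (ZMod p))).mulVec x = 0 := by
    rw [Matrix.sub_mulVec, hx, Matrix.smul_mulVec, Matrix.one_mulVec, sub_self]
  have hdet0 : (M - ε • (1 : Matrix (Fin 2) (Fin 2) (ZMod p))).det = 0 :=
    (Matrix.exists_mulVec_eq_zero_iff).mp ⟨x, hx0, h0⟩
  rw [Matrix.det_fin_two] at hdet hdet0
  simp only [Matrix.sub_apply, Matrix.smul_apply, Matrix.one_apply_eq,
    Matrix.one_apply_ne (show (0 : Fin 2) ≠ 1 by decide),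
    Matrix.one_apply_ne (show (1 : Fin 2) ≠ 0 by decide), smul_eq_mul, mul_one, mul_zero, sub_zero] at hdet0
  have hε2 : ε ^ 2 = 1 := by rcases hε with rfl | rfl <;> ring
  have h4 : (4 : ZMod p) = 0 := by linear_combination hdet0 - hdet + ε * htr - hε2
  haveI : NeZero p := ⟨(Fact.out : p.Prime).ne_zero⟩
  have h4' : ((4 : ℕ) : ZMod p) = 0 := by rw [Nat.cast_ofNat]; exact h4
  exact natCast_zmod_ne_zero_of_lt (by norm_num) (by rcases hp57 with rfl | rfl <;> norm_num) h4'

/-- `tr (z · (1 t; 0 1)) = tr z + z₁₀ t`. [folklore] -/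
theorem trace_mul_upper {R : Type*} [CommRing R] (z : Matrix (Fin 2) (Fin 2) R) (t : R) :
    (z * !![1, t; 0, 1]) 0 0 + (z * !![1, t; 0, 1]) 1 1 = z 0 0 + z 1 1 + z 1 0 * t := by
  simp [Matrix.mul_apply, Fin.sum_univ_two]
  ring

/-- `tr (z · (1 0; u 1)) = tr z + z₀₁ u`. [folklore] -/
theorem trace_mul_lower {R : Type*} [CommRing R] (z : Matrix (Fin 2) (Fin 2) R) (u : R) :
    (z * !![1, 0; u, 1]) 0 0 + (z * !![1, 0; u, 1]) 1 1 = z 0 0 + z 1 1 + z 0 1 * u := by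
  simp [Matrix.mul_apply, Fin.sum_univ_two]
  ring

/-- `tr (z · (1 1; 0 1) · (1 0; u 1)) = tr z + z₁₀ + (z₀₀ + z₀₁ + z₁₀ + z₁₁ u·0) …` — precisely
`= z₀₀ + z₁₁ + z₁₀ + (z₀₀ + z₀₁) u + z₁₀ u + z₁₁ u − z₁₁ u`; we only record the diagonal case `z₀₁ = z₁₀ = 0`:
`tr = z₀₀ + z₁₁ + z₀₀ u`. [folklore] -/
theorem trace_mul_upper_lower_of_diag {R : Type*} [CommRing R] (z : Matrix (Fin 2) (Fin 2) R)
    (h01 : z 0 1 = 0) (h10 : z 1 0 = 0) (u : R) :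
    (z * ((!![1, 1; 0, 1] : Matrix (Fin 2) (Fin 2) R) * !![1, 0; u, 1])) 0 0 +
        (z * ((!![1, 1; 0, 1] : Matrix (Fin 2) (Fin 2) R) * !![1, 0; u, 1])) 1 1 =
      z 0 0 + z 1 1 + z 0 0 * u := by
  simp [Matrix.mul_apply, Fin.sum_univ_two, h01, h10]
  ring

/-! ### §3 The Galois element for a surjective image -/

/-- `χ̄_p(σ) ≡ χ_{4p}(σ) (mod p)`: the mod-`p` cyclotomic character is the reduction of the mod-`4p` one
(`ζ_p = ζ_{4p}^4`). [folklore] -/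
theorem modP_eq_mod4p_val (p : ℕ) [Fact p.Prime] (σ : absoluteGaloisGroup ℚ) :
    ((modPCyclotomicCharacterZMod ℚ p σ : (ZMod p)ˣ) : ZMod p) =
      (((modNCyclotomicCharacter ℚ (4 * p) σ : (ZMod (4 * p))ˣ) : ZMod (4 * p)).val : ZMod p) := by
  have hp : p.Prime := Fact.out
  haveI : NeZero p := ⟨hp.ne_zero⟩
  haveI : NeZero (4 * p) := ⟨mul_ne_zero (by norm_num) hp.ne_zero⟩
  haveI : NeZero ((4 * p : ℕ) : ℚ) := NeZero.charZero
  haveI : NeZero (p : ℚ) := NeZero.charZero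
  obtain ⟨ζ, hζ⟩ := HasEnoughRootsOfUnity.exists_primitiveRoot (AlgebraicClosure ℚ) (4 * p)
  have hζp : IsPrimitiveRoot (ζ ^ 4) p := hζ.pow (NeZero.pos _) (by ring)
  have hsmul := modNCyclotomicCharacter_spec ℚ (4 * p) σ ζ hζ.pow_eq_one
  have h4 : σ • (ζ ^ 4) = (ζ ^ 4) ^ ((modNCyclotomicCharacter ℚ (4 * p) σ : ZMod (4 * p))).val := by
    rw [smul_pow', hsmul, ← pow_mul, ← pow_mul, mul_comm]
  rw [modPCyclotomicCharacterZMod_eq_modNCyclotomicCharacter]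
  exact modNCyclotomicCharacter_eq_of_smul_eq_pow ℚ p hζp σ h4

/-- **The Galois element for a curve with surjective mod-`p` image** (`p ∈ {5,7}`): some `σ ∈ Γ_ℚ` has
`χ_{4p}(σ) = 2p + 3` and `ρ̄_{E,p}(σ)` without eigenvalue `±1` (indeed of trace `0` and determinant `3`):
`σ = ζ · ⁅x,y⁆ · ⁅x',y'⁆` with `χ_{4p}(ζ) = 2p + 3` and commutators realising transvections (see the module
docstring). [cite: SilvermanAEC2009, III.7 (Aut(E[m]) ≅ GL₂(ℤ/mℤ))] [cite: SilvermanCSS1997, Ch. II §7 Proposition and §8] -/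
theorem exists_galois_transfer_of_surjective (W : WeierstrassCurve ℚ) [W.IsElliptic] (p : ℕ) [Fact p.Prime]
    (hp57 : p = 5 ∨ p = 7) (hsurj : W.HasSurjectiveModNGaloisRep p) :
    ∃ σ : absoluteGaloisGroup ℚ,
      (∀ ℓ : ℕ, ((ℓ : ZMod (4 * p)) = (modNCyclotomicCharacter ℚ (4 * p) σ : ZMod (4 * p))) →
        ¬ IsSquare ((((-1 : ℤ) ^ (ℓ / 2) * ℓ : ℤ)) : ZMod p) ∧ ¬ (p : ℤ) ∣ (ℓ : ℤ) - 1) ∧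
      (∀ P : geomTorsion W p, σ • P = P → P = 0) ∧
      (∀ P : geomTorsion W p, σ • P = -P → P = 0) := by
  have hp : p.Prime := Fact.out
  haveI : NeZero p := ⟨hp.ne_zero⟩
  haveI : NeZero (4 * p) := ⟨mul_ne_zero (by norm_num) hp.ne_zero⟩
  haveI : NeZero ((4 * p : ℕ) : ℚ) := NeZero.charZero
  haveI : NeZero (p : ℚ) := NeZero.charZero
  have h20 : (2 : ZMod p) ≠ 0 := by
    have h := natCast_zmod_ne_zero_of_lt (p := p) two_pos (by rcases hp57 with rfl | rfl <;> norm_num)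
    rwa [Nat.cast_ofNat] at h
  have h30 : (3 : ZMod p) ≠ 0 := by
    have h := natCast_zmod_ne_zero_of_lt (p := p) three_pos (by rcases hp57 with rfl | rfl <;> norm_num)
    rwa [Nat.cast_ofNat] at h
  -- a frame and `ρ̄` as matrices
  obtain ⟨P₁, hP₁0⟩ := exists_geomTorsion_ne_zero W p
  obtain ⟨e, -⟩ := exists_addEquiv_apply_eq_single W p hP₁0
  set ρ := rhoMat W e with hρ
  have hρv : ∀ (g : absoluteGaloisGroup ℚ) (T : geomTorsion W p), e (g • T) = (ρ g).mulVec (e T) :=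
    fun g T ↦ rhoMat_mulVec W e g T
  -- lifts of invertible matrices
  have hlift : ∀ g : Matrix (Fin 2) (Fin 2) (ZMod p), g.det ≠ 0 → ∃ x : absoluteGaloisGroup ℚ, ρ x = g := by
    intro g hg
    exact (hasSurjectiveModNGaloisRep_iff_matrix W e).mp hsurj g ⟨g.det⁻¹, mul_inv_cancel₀ hg⟩
  -- `ρ` of an inverse is the inverse matrix
  have hρinv : ∀ (x : absoluteGaloisGroup ℚ) (X' : Matrix (Fin 2) (Fin 2) (ZMod p)),
      ρ x * X' = 1 → ρ x⁻¹ = X' := by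
    intro x X' h
    have h1 : ρ x⁻¹ * ρ x = 1 := by rw [← map_mul, inv_mul_cancel, map_one]
    calc ρ x⁻¹ = ρ x⁻¹ * (ρ x * X') := by rw [h, mul_one]
      _ = (ρ x⁻¹ * ρ x) * X' := by rw [mul_assoc]
      _ = X' := by rw [h1, one_mul]
  -- the class element `ζ`
  set a₀ : ℕ := 2 * p + 3 with ha₀
  have hcop : a₀.Coprime (4 * p) := by
    rw [ha₀]; rcases hp57 with rfl | rfl <;> decide
  obtain ⟨ζ, hζ⟩ := modNCyclotomicCharacter_rat_surjective (4 * p) (ZMod.unitOfCoprime a₀ hcop)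
  have hζval : ((modNCyclotomicCharacter ℚ (4 * p) ζ : (ZMod (4 * p))ˣ) : ZMod (4 * p)) =
      (a₀ : ZMod (4 * p)) := by
    rw [hζ, ZMod.coe_unitOfCoprime]
  set z := ρ ζ with hz
  have hdetz : z.det = 3 := by
    rw [hz, det_eq_modPCyclotomicCharacterZMod_of_exists_weilPairing W p (exists_weilPairing_holds W p) e ζ
      (ρ ζ) (hρv ζ), modP_eq_mod4p_val, hζval, ZMod.val_natCast, ha₀,
      Nat.mod_eq_of_lt (by have := hp.two_le; omega : 2 * p + 3 < 4 * p)]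
    push_cast
    rw [ZMod.natCast_self, mul_zero, zero_add]
  -- `D = diag(-1, 1)` and transvections as commutators `⁅D, U t⁆ = U (-2t)`, `⁅D, L u⁆ = L (-2u)`
  set D : Matrix (Fin 2) (Fin 2) (ZMod p) := !![-1, 0; 0, 1] with hD
  obtain ⟨xD, hxD⟩ := hlift D (by rw [hD, Matrix.det_fin_two_of]; norm_num)
  have hxDinv : ρ xD⁻¹ = D := hρinv xD D (by
    rw [hxD, hD]; ext i j; fin_cases i <;> fin_cases j <;> simp)
  have hcommU : ∀ s : ZMod p, ∃ h : absoluteGaloisGroup ℚ,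
      modNCyclotomicCharacter ℚ (4 * p) h = 1 ∧ ρ h = !![1, s; 0, 1] := by
    intro s
    set t : ZMod p := -(s * 2⁻¹) with ht
    obtain ⟨y, hy⟩ := hlift !![1, t; 0, 1] (by rw [Matrix.det_fin_two_of]; norm_num)
    have hyinv : ρ y⁻¹ = !![1, -t; 0, 1] := hρinv y _ (by
      rw [hy]; ext i j; fin_cases i <;> fin_cases j <;> simp)
    refine ⟨⁅xD, y⁆, ?_, ?_⟩
    · rw [map_commutatorElement, (Commute.all _ _).commutator_eq]
    · rw [commutatorElement_def, map_mul, map_mul, map_mul, hxD, hy, hxDinv, hyinv, hD]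
      have hs : s = -(2 * t) := by
        rw [ht, mul_neg, neg_neg, mul_comm s, ← mul_assoc, mul_inv_cancel₀ h20, one_mul]
      rw [hs]
      ext i j
      fin_cases i <;> fin_cases j <;> simp [Matrix.mul_apply, Fin.sum_univ_two]
      ring
  have hcommL : ∀ s : ZMod p, ∃ h : absoluteGaloisGroup ℚ,
      modNCyclotomicCharacter ℚ (4 * p) h = 1 ∧ ρ h = !![1, 0; s, 1] := by
    intro s
    set t : ZMod p := -(s * 2⁻¹) with ht
    obtain ⟨y, hy⟩ := hlift !![1, 0; t, 1] (by rw [Matrix.det_fin_two_of]; norm_num)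
    have hyinv : ρ y⁻¹ = !![1, 0; -t, 1] := hρinv y _ (by
      rw [hy]; ext i j; fin_cases i <;> fin_cases j <;> simp)
    refine ⟨⁅xD, y⁆, ?_, ?_⟩
    · rw [map_commutatorElement, (Commute.all _ _).commutator_eq]
    · rw [commutatorElement_def, map_mul, map_mul, map_mul, hxD, hy, hxDinv, hyinv, hD]
      have hs : s = -(2 * t) := by
        rw [ht, mul_neg, neg_neg, mul_comm s, ← mul_assoc, mul_inv_cancel₀ h20, one_mul]
      rw [hs]
      ext i j
      fin_cases i <;> fin_cases j <;> simp [Matrix.mul_apply, Fin.sum_univ_two]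
      ring
  -- an `h` with `χ(h) = 1`, `det ρ(h) = 1` and `tr (z ρ(h)) = 0`
  have hk : ∃ h : absoluteGaloisGroup ℚ, modNCyclotomicCharacter ℚ (4 * p) h = 1 ∧ (ρ h).det = 1 ∧
      (z * ρ h) 0 0 + (z * ρ h) 1 1 = 0 := by
    by_cases h10 : z 1 0 = 0
    · by_cases h01 : z 0 1 = 0
      · -- diagonal `z`
        have h00 : z 0 0 ≠ 0 := by
          intro h0
          have : z.det = 0 := by rw [Matrix.det_fin_two, h0, h01, zero_mul, zero_mul, sub_zero]
          rw [hdetz] at this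
          exact h30 this
        obtain ⟨h₁, hχ₁, hh₁⟩ := hcommU 1
        obtain ⟨h₂, hχ₂, hh₂⟩ := hcommL (-(z 0 0 + z 1 1) * (z 0 0)⁻¹)
        refine ⟨h₁ * h₂, by rw [map_mul, hχ₁, hχ₂, mul_one], ?_, ?_⟩
        · rw [map_mul, hh₁, hh₂, Matrix.det_mul, Matrix.det_fin_two_of, Matrix.det_fin_two_of]; ring
        · rw [map_mul, hh₁, hh₂, trace_mul_upper_lower_of_diag z h01 h10, mul_comm (z 0 0) (_ * _),
            mul_assoc, inv_mul_cancel₀ h00, mul_one, add_neg_cancel]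
      · obtain ⟨h, hχ, hh⟩ := hcommL (-(z 0 0 + z 1 1) * (z 0 1)⁻¹)
        refine ⟨h, hχ, by rw [hh, Matrix.det_fin_two_of]; ring, ?_⟩
        rw [hh, trace_mul_lower, mul_comm (z 0 1) (_ * _), mul_assoc, inv_mul_cancel₀ h01, mul_one,
          add_neg_cancel]
    · obtain ⟨h, hχ, hh⟩ := hcommU (-(z 0 0 + z 1 1) * (z 1 0)⁻¹)
      refine ⟨h, hχ, by rw [hh, Matrix.det_fin_two_of]; ring, ?_⟩
      rw [hh, trace_mul_upper, mul_comm (z 1 0) (_ * _), mul_assoc, inv_mul_cancel₀ h10, mul_one,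
        add_neg_cancel]
  obtain ⟨h, hχh, hdeth, htr⟩ := hk
  have hdet : (z * ρ h).det = 3 := by rw [Matrix.det_mul, hdetz, hdeth, mul_one]
  have hex : ∀ P : geomTorsion W p, e P = 0 → P = 0 := fun P hP ↦ e.injective (by rw [hP, map_zero])
  refine ⟨ζ * h, ?_, ?_, ?_⟩
  · intro ℓ hℓ
    rw [map_mul, hχh, mul_one, hζval] at hℓ
    exact transferClass_facts hp57 hℓ
  · intro P hP
    refine hex P (mulVec_eq_smul_sign_imp_zero hp57 htr hdet (Or.inl rfl) (x := e P) ?_)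
    rw [one_smul, hz, ← map_mul, ← hρv, hP]
  · intro P hP
    refine hex P (mulVec_eq_smul_sign_imp_zero hp57 htr hdet (Or.inr rfl) (x := e P) ?_)
    rw [neg_one_smul, hz, ← map_mul, ← hρv, hP, map_neg]

/-- **The transfer witness `hW″` for curves with surjective mod-`p` image — PROVED.** For `p ∈ {5, 7}` and
every globally minimal `V₀/ℚ` with `ρ̄_{E,p}` onto `GL₂(𝔽_p)` there is a prime `q ∤ 2 p N(V₀)` with `q*` a
non-residue mod `p` and `p ∤ (q − 1)((q + 1)² − a_q(V₀)²)`. Hence, for such curves, the conclusions of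
`LTwistTransfer.twistDegreeStepFiveSeven_of_kato_of_transferWitness` etc. rest on F″ alone (the item-level
statements quantify over `Irr`, which is weaker than surjectivity; the general irreducible case is finite group
theory on the image, not done here). [cite: TateGCFT1967, §2.4] [cite: SilvermanAEC2009, III.7, V.2.3.1, VII.3.1(b)] -/
theorem transferWitness_of_surjective (p : ℕ) [Fact p.Prime] (V₀ : WeierstrassCurve ℚ) [V₀.IsElliptic]
    [V₀.IsGloballyMinimal] (hp57 : p = 5 ∨ p = 7) (hsurj : V₀.HasSurjectiveModNGaloisRep p) :
    ∃ q : ℕ, q.Prime ∧ q ≠ 2 ∧ q ≠ p ∧ ¬ q ∣ V₀.conductorNorm ℤ ∧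
      ¬ IsSquare ((((-1 : ℤ) ^ (q / 2) * q : ℤ)) : ZMod p) ∧
      ¬ (p : ℤ) ∣ ((q : ℤ) - 1) * (((q : ℤ) + 1) ^ 2 - V₀.LFunction q ^ 2) := by
  obtain ⟨σ, hσcl, hσ1, hσ2⟩ := exists_galois_transfer_of_surjective V₀ p hp57 hsurj
  exact exists_transferPrime_of_galois V₀ p hσcl hσ1 hσ2

end Summit.BirchSwinnertonDyer.BirchSwinnertonDyer.Theorems.LTwistTransfer

end
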